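import Literature.Computability.AlgebraicComplexity.GenWordDefs
import HarnessLib

/-!
# Words with arbitrary letter sizes: the queue automaton and `P_w` as a projection of `IMM`

(N. Limaye, S. Srinivasan, S. Tavenas, J. ACM 72 (2025), Art. 26, §2.2 and Lemma 22; the
general-word form of `WordAutomaton.lean`, over the definitions of `GenWordDefs.lean`.)

For a word with size function `sz : Fin d → ℕ` and signs `pos`, the stream bookkeeping
(`length_stream`, `wsum_prefix_eq`, `overLen_eq_natAbs`, `length_overhang`), the
correctness of the queue automaton with its dynamic length check (`run_wordStep`: after `t ≤ d`
blocks the run is defined iff the two streams are compatible, and then the state is the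
overhang; `accepts_wordStep_iff`), and the two facts the lower bound consumes:
**`aeval_wordSubst_immPoly`** — `P_w` is the image of `IMM_{n,d}` under `wordSubst` as soon as
`n ≥ 2^{|w_{[t]}|}` for all `t` — and **`isBlockPreserving_wordSubst`**.  Proofs are those of
`WordAutomaton.lean` with `letterSize k pos` replaced by `sz`.

## References

* N. Limaye, S. Srinivasan, S. Tavenas, J. ACM 72 (2025), Art. 26, §2.2, Lemma 22, Lemma 8.
-/

noncomputable section

open MvPolynomial

namespace Literature.Computability.AlgebraicComplexity

namespace GenWord

open LSTWord (Compat compat_comm compat_iff_prefix_of_le compat_append_iff_of_le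
  compat_append_iff_of_lt drop_append_of_le ne_not_self' bitsEquivFin)

universe u

/-! ### Unfolding the recursions -/

section Streams

variable {d : ℕ} (sz : Fin d → ℕ) (pos : Fin d → Bool)

/-- The empty stream. [cite: LimayeSrinivasanTavenas2025, §2.2] -/
@[simp]
theorem stream_zero (sgn : Bool) (w : (i : Fin d) → BlockVar sz i) : stream sz pos sgn w 0 = [] :=
  rfl

/-- Unfolding the stream one block further. [cite: LimayeSrinivasanTavenas2025, §2.2] -/
theorem stream_succ' (sgn : Bool) (w : (i : Fin d) → BlockVar sz i) (t : ℕ) :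
    stream sz pos sgn w (t + 1) = stream sz pos sgn w t ++
      (if h : t < d then (if pos ⟨t, h⟩ = sgn then List.ofFn (w ⟨t, h⟩) else []) else []) :=
  rfl

/-- The empty stream has length `0`. [cite: LimayeSrinivasanTavenas2025, §2.2] -/
@[simp]
theorem streamLen_zero (sgn : Bool) : streamLen sz pos sgn 0 = 0 := rfl

/-- Unfolding the stream length one block further. [cite: LimayeSrinivasanTavenas2025, §2.2] -/
theorem streamLen_succ' (sgn : Bool) (t : ℕ) :
    streamLen sz pos sgn (t + 1) = streamLen sz pos sgn t +
      (if h : t < d then (if pos ⟨t, h⟩ = sgn then sz ⟨t, h⟩ else 0) else 0) :=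
  rfl

/-- Unfolding the stream one block further, inside the range.
[cite: LimayeSrinivasanTavenas2025, §2.2] -/
theorem stream_succ (sgn : Bool) (w : (i : Fin d) → BlockVar sz i) {t : ℕ} (ht : t < d) :
    stream sz pos sgn w (t + 1) = stream sz pos sgn w t ++
      (if pos ⟨t, ht⟩ = sgn then List.ofFn (w ⟨t, ht⟩) else []) := by
  rw [stream_succ', dif_pos ht]

/-- Unfolding the stream length one block further, inside the range.
[cite: LimayeSrinivasanTavenas2025, §2.2] -/
theorem streamLen_succ (sgn : Bool) {t : ℕ} (ht : t < d) :
    streamLen sz pos sgn (t + 1) = streamLen sz pos sgn t +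
      (if pos ⟨t, ht⟩ = sgn then sz ⟨t, ht⟩ else 0) := by
  rw [streamLen_succ', dif_pos ht]

/-- Beyond the range the stream length is constant. [cite: LimayeSrinivasanTavenas2025, §2.2] -/
theorem streamLen_succ_of_le (sgn : Bool) {t : ℕ} (ht : d ≤ t) :
    streamLen sz pos sgn (t + 1) = streamLen sz pos sgn t := by
  rw [streamLen_succ', dif_neg (not_lt.2 ht), add_zero]

/-- The stream after `t` blocks has length `streamLen`. [cite: LimayeSrinivasanTavenas2025, §2.2] -/
@[simp]
theorem length_stream (sgn : Bool) (w : (i : Fin d) → BlockVar sz i) (t : ℕ) :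
    (stream sz pos sgn w t).length = streamLen sz pos sgn t := by
  induction t with
  | zero => rfl
  | succ t ih =>
    rw [stream_succ', streamLen_succ', List.length_append, ih]
    split_ifs <;> simp

/-- The stream of sign `sgn` only reads the blocks of that sign below `t`.
[cite: LimayeSrinivasanTavenas2025, §2.2] -/
theorem stream_congr (sgn : Bool) {w w' : (i : Fin d) → BlockVar sz i} (t : ℕ)
    (h : ∀ i : Fin d, (i : ℕ) < t → pos i = sgn → w i = w' i) :
    stream sz pos sgn w t = stream sz pos sgn w' t := by
  induction t with
  | zero => rfl
  | succ t ih =>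
    rw [stream_succ', stream_succ', ih fun i hi hs => h i (Nat.lt_succ_of_lt hi) hs]
    by_cases ht : t < d
    · simp only [dif_pos ht]
      by_cases hs : pos ⟨t, ht⟩ = sgn
      · rw [if_pos hs, if_pos hs, h ⟨t, ht⟩ (Nat.lt_succ_self t) hs]
      · rw [if_neg hs, if_neg hs]
    · simp only [dif_neg ht]

/-- The prefix sum `w_{[t]}` of the word is the difference of the stream lengths.
[cite: LimayeSrinivasanTavenas2025, §2.2] -/
theorem wsum_prefix_eq (t : ℕ) (ht : t ≤ d) :
    wsum sz pos (Finset.univ.filter fun i : Fin d => (i : ℕ) < t) =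
      (streamLen sz pos true t : ℤ) - streamLen sz pos false t := by
  induction t with
  | zero => simp [wsum]
  | succ t ih =>
    have ht' : t < d := Nat.lt_of_succ_le ht
    have hsplit : (Finset.univ.filter fun i : Fin d => (i : ℕ) < t + 1) =
        insert ⟨t, ht'⟩ (Finset.univ.filter fun i : Fin d => (i : ℕ) < t) := by
      ext i
      simp only [Finset.mem_filter, Finset.mem_univ, true_and, Finset.mem_insert, Fin.ext_iff]
      omega
    have hnot : (⟨t, ht'⟩ : Fin d) ∉ (Finset.univ.filter fun i : Fin d => (i : ℕ) < t) := by
      simp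
    rw [wsum, hsplit, Finset.sum_insert hnot, ← wsum, ih ht'.le, streamLen_succ sz pos _ ht',
      streamLen_succ sz pos _ ht', wt]
    cases pos ⟨t, ht'⟩ <;> simp <;> ring

/-- The stream lengths beyond the range. [cite: LimayeSrinivasanTavenas2025, §2.2] -/
theorem streamLen_of_le (sgn : Bool) {t : ℕ} (ht : d ≤ t) :
    streamLen sz pos sgn t = streamLen sz pos sgn d := by
  induction t with
  | zero =>
    have hd : d = 0 := Nat.le_zero.1 ht
    subst hd; rfl
  | succ t ih =>
    rcases Nat.lt_or_ge t d with h | h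
    · have : d = t + 1 := le_antisymm ht h
      subst this; rfl
    · rw [streamLen_succ_of_le sz pos sgn h, ih h]

/-- Compatibility of the streams in terms of any sign and its opposite.
[cite: LimayeSrinivasanTavenas2025, §2.2] -/
theorem compat_stream_iff (sgn : Bool) (w : (i : Fin d) → BlockVar sz i) (t : ℕ) :
    Compat (stream sz pos true w t) (stream sz pos false w t) ↔
      Compat (stream sz pos sgn w t) (stream sz pos (!sgn) w t) := by
  cases sgn
  · exact compat_comm _ _
  · exact Iff.rfl

/-- The overhang length in terms of any sign and its opposite.
[cite: LimayeSrinivasanTavenas2025, Lemma 22] -/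
theorem overLen_eq (sgn : Bool) (t : ℕ) :
    overLen sz pos t = (streamLen sz pos sgn t - streamLen sz pos (!sgn) t) +
      (streamLen sz pos (!sgn) t - streamLen sz pos sgn t) := by
  unfold overLen
  cases sgn
  · simp only [Bool.not_false]; omega
  · simp only [Bool.not_true]

/-- The overhang length is the absolute value of the prefix sum `w_{[t]}`.
[cite: LimayeSrinivasanTavenas2025, Lemma 22] -/
theorem overLen_eq_natAbs (t : ℕ) (ht : t ≤ d) :
    overLen sz pos t = (wsum sz pos (Finset.univ.filter fun i : Fin d => (i : ℕ) < t)).natAbs := by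
  rw [wsum_prefix_eq sz pos t ht, overLen]
  omega

/-- The empty word has no overhang. [cite: LimayeSrinivasanTavenas2025, Lemma 22] -/
@[simp]
theorem overLen_zero : overLen sz pos 0 = 0 := rfl

/-- Beyond the range the overhang length is that of the full word.
[cite: LimayeSrinivasanTavenas2025, Lemma 22] -/
theorem overLen_of_le {t : ℕ} (ht : d ≤ t) : overLen sz pos t = overLen sz pos d := by
  unfold overLen
  rw [streamLen_of_le sz pos true ht, streamLen_of_le sz pos false ht]

/-- The overhang has length `overLen`. [cite: LimayeSrinivasanTavenas2025, Lemma 22] -/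
@[simp]
theorem length_overhang (w : (i : Fin d) → BlockVar sz i) (t : ℕ) :
    (overhang sz pos w t).length = overLen sz pos t := by
  unfold overhang overLen
  split_ifs with h <;> simp <;> omega

/-- The overhang in terms of the block's own sign: if the stream of sign `sgn` is at least as
long, the overhang is its tail beyond the other stream's length, otherwise the converse.
[cite: LimayeSrinivasanTavenas2025, Lemma 22] -/
theorem overhang_eq (sgn : Bool) (w : (i : Fin d) → BlockVar sz i) (t : ℕ) :
    overhang sz pos w t =
      if streamLen sz pos (!sgn) t ≤ streamLen sz pos sgn t then
        (stream sz pos sgn w t).drop (streamLen sz pos (!sgn) t)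
      else (stream sz pos (!sgn) w t).drop (streamLen sz pos sgn t) := by
  unfold overhang
  cases sgn
  · simp only [Bool.not_false]
    by_cases h1 : streamLen sz pos false t ≤ streamLen sz pos true t <;>
      by_cases h2 : streamLen sz pos true t ≤ streamLen sz pos false t
    · have heq : streamLen sz pos true t = streamLen sz pos false t := le_antisymm h2 h1
      rw [if_pos h1, if_pos h2]
      rw [List.drop_eq_nil_of_le (by simp [heq]), List.drop_eq_nil_of_le (by simp [heq])]
    · rw [if_pos h1, if_neg h2]
    · rw [if_neg h1, if_pos h2]
    · omega
  · simp only [Bool.not_true]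

/-- The overhang of the empty prefix is empty. [cite: LimayeSrinivasanTavenas2025, Lemma 22] -/
@[simp]
theorem overhang_zero (w : (i : Fin d) → BlockVar sz i) : overhang sz pos w 0 = [] := by
  unfold overhang; simp

end Streams

/-! ### The queue automaton (LST 2025, Lemma 22) -/

section Automaton

variable {d : ℕ} (sz : Fin d → ℕ) (pos : Fin d → Bool)

/-- The dynamic length check succeeds on a string of the right length (the bookkeeping of the
queue automaton, LST 2025, Lemma 22). [cite: LimayeSrinivasanTavenas2025, Lemma 22] -/
theorem castVec_eq_some {l : List Bool} {m : ℕ} (h : l.length = m) :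
    castVec l m = some ⟨l, h⟩ := by
  unfold castVec; rw [dif_pos h]

/-- Overhang length after a *push* (block `t` on the longer-or-equal side):
`|w_{[t+1]}| = |w_{[t]}| + |w_t|`. [cite: LimayeSrinivasanTavenas2025, Lemma 22] -/
theorem overLen_succ_of_le (t : Fin d)
    (hle : streamLen sz pos (!pos t) t ≤ streamLen sz pos (pos t) t) :
    overLen sz pos (t.val + 1) = overLen sz pos t + sz t := by
  rw [overLen_eq sz pos (pos t) t, overLen_eq sz pos (pos t) (t.val + 1),
    streamLen_succ sz pos _ t.2, streamLen_succ sz pos _ t.2, if_pos rfl,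
    if_neg (ne_not_self' (pos t))]
  simp only [Fin.eta, add_zero]
  omega

/-- Overhang length after a *compare* (block `t` on the shorter side):
`|w_{[t+1]}|` is the distance between `|w_{[t]}|` and `|w_t|`.
[cite: LimayeSrinivasanTavenas2025, Lemma 22] -/
theorem overLen_succ_of_lt (t : Fin d)
    (hlt : streamLen sz pos (pos t) t < streamLen sz pos (!pos t) t) :
    overLen sz pos (t.val + 1) = (overLen sz pos t - sz t) + (sz t - overLen sz pos t) := by
  rw [overLen_eq sz pos (pos t) t, overLen_eq sz pos (pos t) (t.val + 1),
    streamLen_succ sz pos _ t.2, streamLen_succ sz pos _ t.2, if_pos rfl,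
    if_neg (ne_not_self' (pos t))]
  simp only [Fin.eta, add_zero]
  omega

/-- The transition in the push case. [cite: LimayeSrinivasanTavenas2025, Lemma 22] -/
theorem wordStep_of_le (t : Fin d) (o : List.Vector Bool (overLen sz pos t)) (b : BlockVar sz t)
    (hle : streamLen sz pos (!pos t) t ≤ streamLen sz pos (pos t) t) :
    wordStep sz pos t o b = some ⟨o.1 ++ List.ofFn b, by
      rw [List.length_append, List.length_ofFn, o.2, overLen_succ_of_le sz pos t hle]⟩ := by
  unfold wordStep
  rw [if_pos hle, castVec_eq_some]

/-- The transition in the compare case. [cite: LimayeSrinivasanTavenas2025, Lemma 22] -/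
theorem wordStep_of_lt (t : Fin d) (o : List.Vector Bool (overLen sz pos t)) (b : BlockVar sz t)
    (hlt : streamLen sz pos (pos t) t < streamLen sz pos (!pos t) t) :
    wordStep sz pos t o b =
      if Compat (List.ofFn b) o.1 then
        some ⟨if sz t ≤ overLen sz pos t then o.1.drop (sz t) else (List.ofFn b).drop (overLen sz pos t),
          by
            have ho : o.1.length = overLen sz pos t := o.2
            have hlen := overLen_succ_of_lt sz pos t hlt
            split_ifs with h
            · rw [List.length_drop]; omega
            · rw [List.length_drop, List.length_ofFn]; omega⟩
      else none := by
  unfold wordStep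
  rw [if_neg (not_le.2 hlt)]
  split_ifs with hc
  · rw [castVec_eq_some]
  · rw [castVec_eq_some]
  · rfl

/-- **Correctness of the queue automaton** (LST 2025, Lemma 22: the vertex `v_τ` of layer `i`
collects exactly the monomials `m` over `X_1, …, X_i` with `σ(m⁺) = σ(m⁻) τ`, resp.
`σ(m⁻) τ = σ(m⁺)`): after `t ≤ d` blocks the run is defined iff the two streams are compatible,
and then the state is the overhang. [cite: LimayeSrinivasanTavenas2025, Lemma 22] -/
theorem run_wordStep (w : (i : Fin d) → BlockVar sz i) (t : ℕ) (ht : t ≤ d) :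
    LayeredAutomaton.run (St := fun t => List.Vector Bool (overLen sz pos t))
        (wordStart sz pos) (wordStep sz pos) w t =
      if Compat (stream sz pos true w t) (stream sz pos false w t) then
        some ⟨overhang sz pos w t, length_overhang sz pos w t⟩ else none := by
  induction t with
  | zero =>
    have hv : Compat (stream sz pos true w 0) (stream sz pos false w 0) := Or.inl List.prefix_rfl
    rw [if_pos hv]
    change some (wordStart sz pos) = _
    congr 1
  | succ t ih =>
    have ht' : t < d := Nat.lt_of_succ_le ht
    rw [LayeredAutomaton.run_succ _ _ _ _ ht', ih ht'.le]
    by_cases hv : Compat (stream sz pos true w t) (stream sz pos false w t)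
    · rw [if_pos hv, Option.bind_some]
      set sgn := pos ⟨t, ht'⟩ with hsgn
      have hp : stream sz pos sgn w (t + 1) = stream sz pos sgn w t ++ List.ofFn (w ⟨t, ht'⟩) := by
        rw [stream_succ sz pos sgn w ht', if_pos hsgn.symm]
      have hq : stream sz pos (!sgn) w (t + 1) = stream sz pos (!sgn) w t := by
        rw [stream_succ sz pos (!sgn) w ht', if_neg (by rw [hsgn]; cases pos ⟨t, ht'⟩ <;> simp),
          List.append_nil]
      have hlenq : streamLen sz pos (!sgn) (t + 1) = streamLen sz pos (!sgn) t := by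
        rw [streamLen_succ sz pos _ ht', if_neg (by rw [hsgn]; cases pos ⟨t, ht'⟩ <;> simp),
          add_zero]
      have hlenp : streamLen sz pos sgn (t + 1) = streamLen sz pos sgn t + sz ⟨t, ht'⟩ := by
        rw [streamLen_succ sz pos _ ht', if_pos hsgn.symm]
      have hvt : Compat (stream sz pos sgn w t) (stream sz pos (!sgn) w t) :=
        (compat_stream_iff sz pos sgn w t).1 hv
      have hval1 : Compat (stream sz pos true w (t + 1)) (stream sz pos false w (t + 1)) ↔
          Compat (stream sz pos sgn w t ++ List.ofFn (w ⟨t, ht'⟩)) (stream sz pos (!sgn) w t) := by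
        rw [compat_stream_iff sz pos sgn, hp, hq]
      have hlen_sgn : (stream sz pos sgn w t).length = streamLen sz pos sgn t :=
        length_stream _ _ _ _ _
      have hlen_nsgn : (stream sz pos (!sgn) w t).length = streamLen sz pos (!sgn) t :=
        length_stream _ _ _ _ _
      by_cases hle : streamLen sz pos (!sgn) t ≤ streamLen sz pos sgn t
      · -- push case
        rw [wordStep_of_le sz pos ⟨t, ht'⟩ _ _ hle]
        have hv1 : Compat (stream sz pos true w (t + 1)) (stream sz pos false w (t + 1)) := by
          rw [hval1, compat_append_iff_of_le (by rw [hlen_sgn, hlen_nsgn]; exact hle)]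
          exact hvt
        rw [if_pos hv1, Option.some.injEq]
        apply Subtype.ext
        change overhang sz pos w t ++ List.ofFn (w ⟨t, ht'⟩) = overhang sz pos w (t + 1)
        rw [overhang_eq sz pos sgn w t, if_pos hle, overhang_eq sz pos sgn w (t + 1), hlenq, hlenp,
          if_pos (by omega), hp, drop_append_of_le (by rw [hlen_sgn]; exact hle)]
      · -- compare case
        have hlt : streamLen sz pos sgn t < streamLen sz pos (!sgn) t := not_le.1 hle
        rw [wordStep_of_lt sz pos ⟨t, ht'⟩ _ _ hlt]
        have hov : overhang sz pos w t = (stream sz pos (!sgn) w t).drop (streamLen sz pos sgn t) := by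
          rw [overhang_eq sz pos sgn w t, if_neg hle]
        have key := compat_append_iff_of_lt (p := stream sz pos sgn w t)
          (q := stream sz pos (!sgn) w t) (by rw [hlen_sgn, hlen_nsgn]; exact hlt) hvt
          (List.ofFn (w ⟨t, ht'⟩))
        rw [hlen_sgn, ← hov] at key
        by_cases hc : Compat (List.ofFn (w ⟨t, ht'⟩)) (overhang sz pos w t)
        · rw [if_pos hc]
          have hv1 : Compat (stream sz pos true w (t + 1)) (stream sz pos false w (t + 1)) := by
            rw [hval1, key]; exact hc
          rw [if_pos hv1, Option.some.injEq]
          apply Subtype.ext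
          change (if sz ⟨t, ht'⟩ ≤ overLen sz pos t
              then (overhang sz pos w t).drop (sz ⟨t, ht'⟩)
              else (List.ofFn (w ⟨t, ht'⟩)).drop (overLen sz pos t)) = overhang sz pos w (t + 1)
          rw [overhang_eq sz pos sgn w (t + 1), hlenq, hlenp, hp, hq]
          by_cases hbo : sz ⟨t, ht'⟩ ≤ overLen sz pos t
          · rw [if_pos hbo, hov, List.drop_drop]
            by_cases hcase : streamLen sz pos (!sgn) t ≤ streamLen sz pos sgn t + sz ⟨t, ht'⟩
            · have heq : streamLen sz pos (!sgn) t = streamLen sz pos sgn t + sz ⟨t, ht'⟩ := by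
                have : overLen sz pos t = streamLen sz pos (!sgn) t - streamLen sz pos sgn t := by
                  rw [overLen_eq sz pos sgn t]; omega
                omega
              rw [if_pos hcase, List.drop_eq_nil_of_le (by rw [hlen_nsgn, heq]),
                List.drop_eq_nil_of_le (by simp [hlen_sgn, heq])]
            · rw [if_neg hcase]
          · rw [if_neg hbo]
            have hol : overLen sz pos t = streamLen sz pos (!sgn) t - streamLen sz pos sgn t := by
              rw [overLen_eq sz pos sgn t]; omega
            have hcase : streamLen sz pos (!sgn) t ≤ streamLen sz pos sgn t + sz ⟨t, ht'⟩ := by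
              omega
            rw [if_pos hcase, List.drop_append,
              List.drop_eq_nil_of_le (as := stream sz pos sgn w t) (by rw [hlen_sgn]; omega),
              List.nil_append, hlen_sgn]
            congr 1
        · rw [if_neg hc]
          have hv1 : ¬ Compat (stream sz pos true w (t + 1)) (stream sz pos false w (t + 1)) := by
            rw [hval1, key]; exact hc
          rw [if_neg hv1]
    · rw [if_neg hv, Option.bind_none]
      have hv1 : ¬ Compat (stream sz pos true w (t + 1)) (stream sz pos false w (t + 1)) := by
        intro h1
        apply hv
        rw [compat_stream_iff sz pos (pos ⟨t, ht'⟩)] at h1 ⊢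
        rw [stream_succ sz pos _ w ht', if_pos rfl, stream_succ sz pos _ w ht',
          if_neg (by cases pos ⟨t, ht'⟩ <;> simp), List.append_nil] at h1
        exact h1.of_append_left
      rw [if_neg hv1]

/-- **Acceptance = compatibility of the full streams**: the queue automaton accepts exactly
the assignments whose monomial belongs to `P_w` (LST 2025, Lemma 22).
[cite: LimayeSrinivasanTavenas2025, Lemma 22] -/
theorem accepts_wordStep_iff (w : (i : Fin d) → BlockVar sz i) :
    LayeredAutomaton.Accepts (St := fun t => List.Vector Bool (overLen sz pos t))
        (wordStart sz pos) (wordStep sz pos) w ↔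
      Compat (stream sz pos true w d) (stream sz pos false w d) := by
  unfold LayeredAutomaton.Accepts
  rw [run_wordStep sz pos w d le_rfl]
  split_ifs with h <;> simp [h]

end Automaton

/-! ### `P_w` is a projection of `IMM_{n,d}` -/

section WordPoly

variable {d : ℕ} (sz : Fin d → ℕ) (pos : Fin d → Bool) (K : Type u) [CommSemiring K]
variable {n : ℕ} (hn : ∀ t ≤ d, 2 ^ overLen sz pos t ≤ n)

/-- The state encodings are injective on every layer `t ≤ d`.
[cite: LimayeSrinivasanTavenas2025, Lemma 22] -/
theorem wordEnc_injective (t : ℕ) (ht : t ≤ d) : Function.Injective (wordEnc sz pos hn t) := by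
  intro o o' h
  unfold wordEnc at h
  rw [dif_pos ht, dif_pos ht] at h
  exact (bitsEquivFin _).injective (Fin.castLE_injective _ h)

/-- **`P_w` is a projection of `IMM_{n,d}`** (LST 2025, Lemma 8 / Lemma 22): for `0 < d` and
`n ≥ 2^{|w_{[t]}|}` for all `t`, `aeval (wordSubst) (immPoly n d K) = wordPoly`.
[cite: LimayeSrinivasanTavenas2025, Lemma 8] -/
theorem aeval_wordSubst_immPoly (hd : 0 < d) :
    aeval (wordSubst sz pos K hn) (immPoly n d K) = wordPoly sz pos K := by
  unfold wordSubst wordPoly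
  rw [LayeredAutomaton.aeval_autSubst_immPoly _ _ _ (wordEnc_injective sz pos hn) hd]
  refine Finset.sum_congr rfl fun w _ => ?_
  simp only [accepts_wordStep_iff]

/-- **The substitution is block-preserving**: each `IMM` variable of layer `t` goes to a linear
form in the variables of block `t` (LST 2025, proof of Lemma 8).
[cite: LimayeSrinivasanTavenas2025, Lemma 8] -/
theorem isBlockPreserving_wordSubst :
    IsBlockPreserving (Prod.fst : Fin d × Fin n × Fin n → Fin d)
      (Sigma.fst : (Σ i : Fin d, BlockVar sz i) → Fin d) (wordSubst sz pos K hn) := by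
  intro v
  unfold wordSubst LayeredAutomaton.autSubst
  refine IsWeightedHomogeneous.sum _ _ _ fun b _ => ?_
  split_ifs
  · exact isWeightedHomogeneous_X K _ _
  · exact isWeightedHomogeneous_zero K _ _

/-- The width hypothesis from a bound on the full range: if `2^{|w_{[t]}|} ≤ n` for `t ≤ d` then
it holds for all `t` (the overhang length is constant beyond `d`). [cite: LimayeSrinivasanTavenas2025, Lemma 22] -/
theorem two_pow_overLen_le_of_le {n : ℕ} (hn : ∀ t ≤ d, 2 ^ overLen sz pos t ≤ n) (t : ℕ) :
    2 ^ overLen sz pos t ≤ n := by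
  rcases le_or_gt t d with h | h
  · exact hn t h
  · rw [overLen_of_le sz pos h.le]; exact hn d le_rfl

end WordPoly

end GenWord

end Literature.Computability.AlgebraicComplexity
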